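import Summits.BirchSwinnertonDyer.BirchSwinnertonDyer.Theorems.GenusKolyvaginAtTwoMinimalTwinBSDTwoSwappedPairHeegnerIndex
import Summits.BirchSwinnertonDyer.BirchSwinnertonDyer.Theorems.GenusKolyvaginAtTwoMinimalTwinBSDTwoSwappedPairStarCertificate
import Summits.BirchSwinnertonDyer.BirchSwinnertonDyer.Theorems.GenusKolyvaginAtTwoGenusPrimitiveSupplyAtTwoHeegnerTwinTamagawa
import Literature.NumberTheory.EllipticCurves.HeegnerTraceRelationSplitProofs
import HarnessLib

/-!
# Route `GenusKolyvaginAtTwo`, crux K₁⁻ `K1Neg` (stmt-BirchSwinnertonDyer-31525), LINE 30 «su_halves» (B-branch):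
# THE (★)-FRAME SUPPLY FOR THE TWIN IS BSD-INCONSISTENT ON `Δ < 0` — at every K₁⁻ frame `2 ∣ C(Wd)`, so Gross–Zagier + Milne force
# every Heegner point of the twin `Wd` over every auxiliary Heegner field `K'` to be `2`-divisible, while Kriz–Li's (★) forbids it

Seat `bsd-line-gk2-p3` g32 (PROVER seat 3/3, cell `bsd-f1-sign2`), `--supports stmt-BirchSwinnertonDyer-31525` (helper; closes nothing).
THEOREMS ONLY (no definition, no named fact, no `sorry`); standard axioms.  **BSD is NOT proved by this file; K1Neg / K1Pos are NOT proved;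
no item is closed.**  Every statement here is either UNCONDITIONAL or CONDITIONAL (D-0014) on the route's four STATEMENT-ONLY published facts
(`GrossZagierAllLevels` 24148, `MultPublishedInputsAtTwo` 19921, `EntireLFunctionRat` 19273, `MilneAnyModel` 24149) and on `BSD₂` of a pair of
curves / the leaf `Rank1Residual.NonCMAtTwo` — i.e. on what the route wants to PROVE.  It is a CENSUS CERTIFICATE about the pen's LINE 30
(`Cruxes/K1Neg/Lines/su_halves.lean` v1.3), not progress on BSD.

THE POINT.  LINE 30 proves the rank-one half B of K₁⁻ as `rankOneHalf_of_swap` from three stubs: B1′ `stub_starFrameSupply` (for the twin `Wd` of a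
K₁⁻ frame — analytic rank `1`, `#Sel₂(Wd) = 2`, `ord₂ C(Wd) ≤ 1` — SOME auxiliary Heegner field `K'` of `Wd` with an odd-Manin datum `Dt'`, a
level-`1` datum whose Heegner point descends to `P' ∈ Wd(K')`, a prime `j : K' → ℚ₂` with Kriz–Li's Assumption (★), `c₂(Wd)` odd, and a globally
minimal rank-`0` partner `W' ≅ Wd^(d_K')`), B2′ (swapped Gross–Zagier ledger) and B3 (rank-`0` integrality).  On the K₁⁻ cell `Δ_E < 0`, and for
`Δ_E < 0` EVERY odd-`d_K` Heegner twin has EVEN Tamagawa product (the number of transposition primes of `d_K` is odd — tree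
`GenusKolyTwin.even_tamagawaProduct_twin_of_Δ_neg`): so `ord₂ C(Wd) = 1` on every K₁⁻ frame.  But for a rank-`1` curve with EVEN Tamagawa
product, Gross–Zagier over `K'` (`#Ш_an(Wd ⊗ K') = (I'/(c'·C(Wd)))²`, `I' = [Wd(K') : ℤ y_(K')]`, tree `CMExactDescent.shaAnOverC_baseChange_eq_of_heegner`)
and Milne's exactness-on-the-canonical-model iff (`AdditivePotMult.missingPPartOverCAt_baseChange_iff_bsdp`) turn `BSD₂(Wd) ∧ BSD₂(W')` into
`2 ord₂ I' − 2 ord₂ C(Wd) = ord₂ #Ш(Wd ⊗ K') ≥ 0`, i.e. `2 ∣ I'`, i.e. **`y_(K') ∈ 2·Wd(K')`** at EVERY auxiliary frame `K'` (this is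
Gross–Zagier's own remark that BSD predicts `c·∏ c_q ∣ [E(K):ℤy_K]`, [GrossZagier1986] V.§2 (2.3), read at `p = 2`); whereas Kriz–Li's (★) with
`c₂`, `c_E` odd gives **`y_(K') ∉ 2·Wd(K')`** ([KrizLi2019] Lemma 5.4 — tree theorem `KrizLi2019.not_exists_two_zsmul_eq_of_assumptionStar`).  Hence:

* §1 `twoDiv_derivedPoint_of_bsdp_of_two_dvd_tamagawa'` — my lineage's g28 `TwinSwap.HeegnerIndex.twoDiv_derivedPoint_of_bsdp_of_two_dvd_tamagawa`
  with the twin hypothesis `#Sel₂(Wd) = 1` REMOVED (the rank bookkeeping over `K` now comes from Gross–Zagier–Kolyvagin, not from the twin's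
  Selmer group): `W` rank-`1` with `#Sel₂ = 2` and `2 ∣ C(W)`, `K` odd-`d_K ≠ −3` Heegner, odd-`c` datum, `P(1)` of infinite order, ANY globally
  minimal twin model `Wd`: `BSD₂(W) ∧ BSD₂(Wd)` + PRINT ⟹ `P(1) ∈ 2E(K[1])`.
* §2 `false_of_assumptionStar_of_bsdp_of_two_dvd_tamagawa` — add a (★) certificate (`2` split in `K` makes `d_K ≡ 1 (mod 8)`: odd, `≠ −3`):
  `BSD₂(W) ∧ BSD₂(Wd)` + PRINT ⟹ `False`.  READING: a rank-one curve with EVEN Tamagawa product has NO (★)-frame unless `BSD₂` fails for it or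
  for the rank-zero partner at that frame.
* §3 `K1Neg.starFrame_false_of_bsdp` / `K1Neg.starFrame_false_of_nonCMAtTwo` — ON EVERY K₁⁻ FRAME (binders of `K1Neg` VERBATIM through the
  twin `Wd`), every package of the shape B1′ outputs yields `¬(BSD₂(Wd) ∧ BSD₂(W'))`, resp. `False` from the leaf `NonCMAtTwo` + the four PRINT
  items; `K1Neg.not_starFrameSupply_conclusion_of_nonCMAtTwo` — the conclusion of `stub_starFrameSupply` (its `∃`-package, text VERBATIM) is
  REFUTED modulo the leaf at every K₁⁻ frame.  So LINE 30's B-branch can be completed only if the rung the route closes is FALSE: B1′ is dead on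
  `Δ < 0` (stub-false modulo the leaf).  LINE 31 (K₁⁺, `ord₂ C(Wd) = 0`) is NOT touched by this obstruction.

HONEST FRAMING: valuation bookkeeping over landed theorems; beyond-print inputs are displayed hypotheses; nothing about BSD is proved.  References:
[GrossZagier1986] V.§2 (2.2)–(2.3); [KrizLi2019] FMS Thm. 1.12, Lemma 5.4, Rem. 1.14; [McCallumLMS1991] §5 Lemma 5.1; [Milne1972ArithmeticAV] §1 Thm. 1.
-/

set_option autoImplicit false
set_option linter.dupNamespace false -- `Summit.<P>.<Sub>` repeats `BirchSwinnertonDyer` (D-0017)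

noncomputable section

open scoped Classical

open WeierstrassCurve NumberField Literature.NumberTheory.EllipticCurves Literature.NumberTheory.EllipticCurves.ModularForms
  Literature.NumberTheory.EllipticCurves.Rank1Residual Literature.NumberTheory.EllipticCurves.Rank1Residual.Typed
  Literature.NumberTheory.EllipticCurves.KrizLi2019
  Summit.BirchSwinnertonDyer.Rank1Residual Summit.BirchSwinnertonDyer.Rank1Residual.AdditivePotMult
  Summit.BirchSwinnertonDyer.BirchSwinnertonDyer.Rank1Residual Summit.BirchSwinnertonDyer.BirchSwinnertonDyer.Theses.GenusKolyvaginAtTwo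
  Summit.BirchSwinnertonDyer.BirchSwinnertonDyer.Theorems.CMExactDescent Summit.BirchSwinnertonDyer.BirchSwinnertonDyer.Theorems.GenusExact.TwinSwap

namespace Summit.BirchSwinnertonDyer.BirchSwinnertonDyer.Theorems.GenusExact.SuHalves.StarObstruction

/-! ## §1 `2 ∣ C(E)` ⟹ the BSD pair forces `2 ∣ y_K`, for ANY globally minimal twin (no Selmer hypothesis on the twin) -/

/-- **`2 ∣ C(E)` ⟹ `BSD₂(E) ∧ BSD₂(Wd)` + PRINT force `P(1) ∈ 2E(K[1])`, twin-Selmer-free.**  `W/ℚ` globally minimal of analytic rank `1` with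
`#Sel₂(E) = 2` and `C(E)` EVEN; `K` imaginary quadratic, `d_K` odd `≠ −3`, Heegner for `N_E`; `Dt` with odd `Dt.c`; `d₁` conductor-`1` with `P(1)`
of infinite order; `Wd` ANY globally minimal model of `E^(d_K)`.  Then `P(1)` is `2`-divisible in `E(K[1])`.  (g28's
`TwinSwap.HeegnerIndex.twoDiv_derivedPoint_of_bsdp_of_two_dvd_tamagawa` with `#Sel₂(Wd) = 1` removed: `rank E(ℚ) = 1` from GZK, `E(ℚ)[2] = 0` from
`#Sel₂ = 2`, `rank E(K) = 1` from Gross–Zagier; then `ord₂ #Ш_an(E_K) = 2 ord₂ I − 2 ord₂ C(E) = ord₂ #Ш(E_K) ≥ 0` gives `2 ∣ I`, i.e. `2 ∣ P₀`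
in `E(K)` (rank-one coordinate, odd torsion), i.e. `2 ∣ P(1)` in `E(K[1])`.)  CONDITIONAL on the two `BSD₂` and the four named facts.
[cite: GrossZagier1986, V.§2 (2.2)–(2.3)] [cite: Milne1972ArithmeticAV, §1 Thm. 1] [cite: McCallumLMS1991, §5 Lemma 5.1] [cite: Miller2011LMS, Def. 1.1] -/
theorem twoDiv_derivedPoint_of_bsdp_of_two_dvd_tamagawa'
    (W : WeierstrassCurve ℚ) [W.IsElliptic] [W.IsGloballyMinimal] [NeZero (W.conductorNorm ℤ)]
    (K : Type) [Field K] [NumberField K]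
    (hGZ : gross_zagier (W.conductorNorm ℤ) W K) (hGZK : rank_eq_analyticRank_of_analyticRank_le_one)
    (hmod : hasEntireLFunction_rat) (hMilneC : Milne1972.bsdQuotient_baseChange_quadratic_anyModel)
    (hr : W.analyticRank = 1) (hSel : Nat.card (W.selmerGroup 2) = 2) (h2T : 2 ∣ W.tamagawaProduct)
    (hK : IsImaginaryQuadratic K) (hodd : Odd (NumberField.discr K)) (h3 : NumberField.discr K ≠ -3)
    (hH : SatisfiesHeegnerHypothesis (W.conductorNorm ℤ) K)
    (Dt : ModularParametrizationData W (W.conductorNorm ℤ)) (hc : Odd Dt.c) (β : ℤ) (ι : K →+* ℂ)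
    (d₁ : KolyvaginHeegnerData Dt β ι 1) (hy : ¬ IsOfFinAddOrder d₁.derivedPoint)
    (Wd : WeierstrassCurve ℚ) [Wd.IsElliptic] [Wd.IsGloballyMinimal]
    (hWd : ∃ C : VariableChange ℚ, C • W.quadraticTwist (NumberField.discr K : ℚ) = Wd)
    (hBW : BSDp W 2) (hBd : BSDp Wd 2) :
    ∃ Q : (W.baseChange (ringClassField K ι 1)).toAffine.Point, (2 : ℤ) • Q = d₁.derivedPoint := by
  haveI : Fact (Nat.Prime 2) := ⟨Nat.prime_two⟩
  haveI hEK : (W.baseChange K).IsElliptic := isElliptic_baseChange' W K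
  have h2 : Module.finrank ℚ K = 2 := hK.1
  have hD0 : (NumberField.discr K : ℚ) ≠ 0 := by exact_mod_cast NumberField.discr_ne_zero K
  haveI hEt : (W.quadraticTwist (NumberField.discr K : ℚ)).IsElliptic := W.isElliptic_quadraticTwist hD0
  obtain ⟨-, hDlt⟩ := discr_emod_four_and_lt_of_odd hK hodd h3
  have hw2 : Units.torsionOrder K = 2 :=
    Literature.NumberTheory.QuadraticFields.Quadratic.torsionOrder_eq_two_of_discr_lt_neg_four h2 hDlt
  have hc0 : Dt.c ≠ 0 := by
    obtain ⟨k, hk⟩ := hc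
    omega
  obtain ⟨Cd, hCd⟩ := hWd
  -- the Heegner point `P₀ ∈ E(K)` below `P(1)`, of infinite order
  obtain ⟨P₀, Hd, hP₀, hP₀K⟩ := exists_heegnerPoint_map_eq_derivedPoint_one hK hH d₁
  have hPinf : ¬ IsOfFinAddOrder P₀ := fun hfin ↦ hy (by
    rw [← hP₀K]
    exact (WeierstrassCurve.Affine.Point.map (W' := W) (algebraMap K (ringClassField K ι 1)).toRatAlgHom).isOfFinAddOrder hfin)
  -- `rank E(ℚ) = 1` (GZK), hence `E(ℚ)[2] = 0` (`#Sel₂ = 2`), hence no `2`-torsion over `K` and over `K[1]`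
  obtain ⟨hrankW, -⟩ := hGZK W (by rw [hr])
  have hrk : 1 ≤ W.mordellWeilRank := by rw [hrankW, hr]
  obtain ⟨-, hT2, -⟩ := rank_eq_one_and_sha_primary_eq_zero_of_natCard_selmerGroup_eq_two W hSel hrk
  have hT2' : ∀ P : W.toAffine.Point, 2 • P = 0 → P = 0 := fun P hP ↦ by convert hT2 P (by convert hP)
  have htor1 : ∀ (M : ℕ) (R : (W.baseChange (ringClassField K ι 1)).toAffine.Point),
      ((2 ^ M : ℕ) : ℤ) • R = 0 → R = 0 :=
    fun M R hR ↦ eq_zero_of_two_pow_smul_eq_zero_ringClassField_of_noTwoTorsion W hK hodd hH hT2' ι M R hR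
  have hiv : ∀ x : (W.baseChange K).toAffine.Point, 2 • x = 0 → x = 0 := fun x hx ↦
    forall_two_zsmul_baseChange_eq_zero_of_heegner W K hK hodd hH hT2' x (by rw [← natCast_zsmul] at hx; exact_mod_cast hx)
  -- analytic ranks: `r_an(E^(d_K)) = 0`, `r_an(E_K) = 1`
  have hrt : (W.quadraticTwist (NumberField.discr K : ℚ)).analyticRank = 0 :=
    analyticRank_twist_eq_zero_of_rankOne W K hGZ hmod hK hH hr ⟨Dt, Hd, ι, hP₀⟩ hPinf
  have hrd : Wd.analyticRank = 0 := by rw [← hCd, analyticRank_smul, hrt]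
  have hrK : (W.baseChange K).analyticRank = 1 :=
    (P2.analyticRank_baseChange_eq_one_iff W K hmod h2).mpr (Or.inl ⟨hr, hrt⟩)
  -- Gross–Zagier over `K`: `rank E(K) = 1`, `Ш(E_K)` finite, `#Ш_an(E_K) = 4 I² / (c² w_K² C(E)²)`
  obtain ⟨hrkK, hShaK, -, hshaC⟩ := shaAnOverC_baseChange_eq_of_heegner W K Dt Hd ι P₀ hGZ hGZK hmod hK hH hP₀ hc0 hrK
  haveI hfinK : Finite (W.baseChange K).sha := hShaK
  -- the two `BSD₂` give `ord₂ #Ш_an(E_K) = ord₂ #Ш(E_K)`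
  obtain ⟨q', hq', hv'⟩ :=
    (missingPPartOverCAt_baseChange_iff_bsdp W 2 K Wd hGZK hmod hMilneC (by rw [hr]) h2 ⟨Cd, hCd⟩
      (by rw [hrd]; exact zero_le_one) hBd).mpr hBW
  -- a rank-one coordinate: `ord₂ I = ord₂ |c(P₀)|`
  haveI : Finite (AddCommGroup.torsion (W.baseChange K).toAffine.Point) :=
    WeierstrassCurve.finite_torsion_point (W := W.baseChange K)
  obtain ⟨c, Q, hcQ, hcker⟩ := X11b.RankOne.exists_coord_of_mordellWeilRank_eq_one (W.baseChange K) hrkK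
  have hcP : c P₀ ≠ 0 := fun h0 ↦ hPinf (hcker P₀ h0)
  set I := (AddSubgroup.zmultiples P₀).index with hI_def
  have hIc : padicValNat 2 I = padicValNat 2 (c P₀).natAbs :=
    X11b.RankOne.padicValNat_index_zmultiples_eq c Q hcQ hcker hiv P₀ hcP
  have hI0 : I ≠ 0 := fun hI ↦ by
    have hh := P2.torsionOrder_sq_mul_canonicalHeight_eq_index_sq_mul_regulator (W.baseChange K) hrkK P₀ hPinf
    rw [← hI_def, hI, Nat.cast_zero, zero_pow two_ne_zero, zero_mul, mul_eq_zero, pow_eq_zero_iff two_ne_zero,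
      Nat.cast_eq_zero] at hh
    exact hh.elim (W.baseChange K).torsionOrder_pos_holds.ne'
      (fun h0 ↦ hPinf ((Affine.Point.canonicalHeight_eq_zero_iff_holds P₀).mp h0))
  -- `ord₂ q = 2 ord₂ I − 2 ord₂ C(E)`
  set q : ℚ := 4 * (I : ℚ) ^ 2 /
      ((Dt.c : ℚ) ^ 2 * (Units.torsionOrder K : ℚ) ^ 2 * ((W.tamagawaProduct : ℚ) ^ 2)) with hq_def
  have hqq : q' = q := Rat.cast_injective (α := ℂ) (hq'.symm.trans hshaC)
  have hcQ0 : (Dt.c : ℚ) ≠ 0 := by exact_mod_cast hc0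
  have hC0 : W.tamagawaProduct ≠ 0 := W.tamagawaProduct_pos_holds.ne'
  have hcW0 : (W.tamagawaProduct : ℚ) ≠ 0 := by exact_mod_cast hC0
  have hIQ0 : (I : ℚ) ≠ 0 := by exact_mod_cast hI0
  have hqI : q = ((I : ℚ) / ((Dt.c : ℚ) * (W.tamagawaProduct : ℚ))) ^ 2 := by
    rw [hq_def, hw2]
    push_cast
    field_simp
    ring
  have hvc : padicValRat 2 (Dt.c : ℚ) = 0 := by
    rw [padicValRat.of_int, padicValInt.eq_zero_of_not_dvd (fun h2c ↦
      (Int.not_even_iff_odd.mpr hc) (even_iff_two_dvd.mpr h2c))]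
    rfl
  have hval : padicValRat 2 q = 2 * (padicValNat 2 I : ℤ) - 2 * (padicValNat 2 W.tamagawaProduct : ℤ) := by
    rw [hqI, padicValRat.pow, padicValRat.div hIQ0 (mul_ne_zero hcQ0 hcW0),
      padicValRat.mul hcQ0 hcW0, hvc, padicValRat.of_nat, padicValRat.of_nat]
    push_cast
    ring
  -- `ord₂ C(E) ≥ 1`, `ord₂ #Ш(E_K) ≥ 0`, hence `ord₂ I ≥ 1`
  have hC1 : 1 ≤ padicValNat 2 W.tamagawaProduct := one_le_padicValNat_of_dvd hC0 h2T
  rw [hqq, hval] at hv'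
  have hI1 : 1 ≤ padicValNat 2 (c P₀).natAbs := by
    rw [← hIc]
    have h0 : (0 : ℤ) ≤ (padicValNat 2 (W.baseChange K).shaOrder : ℤ) := by positivity
    omega
  -- `2 ∣ c(P₀)`, so `P₀ ∈ 2E(K)` (the torsion part is `2`-divisible), so `P(1) ∈ 2E(K[1])`
  have h2c : 2 ^ 1 ∣ (c P₀).natAbs := (padicValNat_dvd_iff_le (Int.natAbs_ne_zero.mpr hcP)).mpr hI1
  obtain ⟨a, ha⟩ := Int.ofNat_dvd_left.mpr h2c
  have ht : IsOfFinAddOrder (P₀ - c P₀ • Q) := X11b.RankOne.isOfFinAddOrder_sub_coord_zsmul c Q hcQ hcker P₀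
  obtain ⟨t', ht'⟩ := X11b.LocalIndex.mem_range_nsmul_pow_of_isOfFinAddOrder hiv 1 ht
  have ht'' : (2 ^ 1) • t' = P₀ - c P₀ • Q := by rw [← nsmulAddMonoidHom_apply]; exact ht'
  have hdivK : ∃ R : (W.baseChange K).toAffine.Point, ((2 ^ 1 : ℕ) : ℤ) • R = P₀ := by
    refine ⟨a • Q + t', ?_⟩
    rw [smul_add, smul_smul, ← ha, natCast_zsmul, ht'']
    abel
  have hP : X11b.Three.Koly.PDiv d₁ 2 1 :=
    (X11b.Three.Koly.pDiv_one_iff_exists_zsmul_eq hK d₁ P₀ hP₀K 2 1 (htor1 1)).mpr hdivK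
  simpa [X11b.Three.Koly.PDiv] using hP

/-! ## §2 A (★)-certified frame of a rank-one curve with EVEN Tamagawa product contradicts the BSD pair -/

/-- **`2` split in `K` ⟹ `d_K` odd and `d_K ≠ −3`** (`d_K ≡ 1 (mod 8)`). [cite: Cox2013, §5.B Prop. 5.16] -/
theorem odd_discr_and_ne_neg_three_of_split_two (K : Type) [Field K] [NumberField K] (h2 : Module.finrank ℚ K = 2)
    (hsplit : ((Ideal.span {(2 : ℤ)}).primesOver (𝓞 K)).ncard = 2) :
    Odd (NumberField.discr K) ∧ NumberField.discr K ≠ -3 := by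
  have h8 : NumberField.discr K % 8 = 1 :=
    Literature.NumberTheory.EllipticCurves.HeegnerTraceSplit.discr_emod_eight_of_split_two h2
      (by simpa only [Nat.cast_ofNat] using hsplit)
  refine ⟨?_, fun h ↦ by rw [h] at h8; omega⟩
  rw [Int.odd_iff]
  omega

/-- **A (★)-FRAME OF A RANK-ONE CURVE WITH EVEN TAMAGAWA PRODUCT CONTRADICTS `BSD₂(E) ∧ BSD₂(Wd)`.**  `W/ℚ` globally minimal of analytic rank
`1` with `#Sel₂(E) = 2` and **`2 ∣ C(E)`**; `K` imaginary quadratic, Heegner for `N_E`; an odd-`c` datum `Dt`, a conductor-`1` datum `d₁`,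
`P₀ ∈ E(K)` mapping to `P(1)`, `j : K → ℚ₂` with Kriz–Li's Assumption (★) (`AssumptionStar W Dt K P₀ j`; it contains «`2` split in `K`», so
`d_K ≡ 1 (mod 8)`), `c₂(E)` odd; `Wd` ANY globally minimal model of `E^(d_K)`.  Then `BSD₂(E) ∧ BSD₂(Wd)` + PRINT give `False`: (★) makes `P(1)`
of infinite order and `2`-indivisible in `E(K[1])` (g24 `TwinSwap.Star.not_isOfFinAddOrder_and_not_twoDiv_derivedPoint_of_assumptionStar`, i.e.
[KrizLi2019] Lemma 5.4 + McCallum 5.1), §1 makes it `2`-divisible.  READING: no (★)-frame exists for a rank-one curve with even Tamagawa product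
unless `BSD₂` fails at that frame (Kriz–Li: (★) forces all `c_ℓ` odd — here kernel-checked in the route's currency).
[cite: KrizLi2019, Thm. 1.12 and Lemma 5.4 (FMS)] [cite: GrossZagier1986, V.§2 (2.3)] [cite: Milne1972ArithmeticAV, §1 Thm. 1] -/
theorem false_of_assumptionStar_of_bsdp_of_two_dvd_tamagawa
    (W : WeierstrassCurve ℚ) [W.IsElliptic] [W.IsGloballyMinimal] [NeZero (W.conductorNorm ℤ)]
    (K : Type) [Field K] [NumberField K]
    (hGZ : gross_zagier (W.conductorNorm ℤ) W K) (hGZK : rank_eq_analyticRank_of_analyticRank_le_one)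
    (hmod : hasEntireLFunction_rat) (hMilneC : Milne1972.bsdQuotient_baseChange_quadratic_anyModel)
    (hr : W.analyticRank = 1) (hSel : Nat.card (W.selmerGroup 2) = 2) (h2T : 2 ∣ W.tamagawaProduct)
    (hK : IsImaginaryQuadratic K) (hH : SatisfiesHeegnerHypothesis (W.conductorNorm ℤ) K)
    (Dt : ModularParametrizationData W (W.conductorNorm ℤ)) (hc : Odd Dt.c) (β : ℤ) (ι : K →+* ℂ)
    (d₁ : KolyvaginHeegnerData Dt β ι 1) (P₀ : (W.baseChange K).toAffine.Point)
    (hP₀K : WeierstrassCurve.Affine.Point.map (W' := W) (algebraMap K (ringClassField K ι 1)).toRatAlgHom P₀ = d₁.derivedPoint)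
    (j : K →ₐ[ℚ] ℚ_[2]) (hstar : AssumptionStar W Dt K P₀ j)
    (hc2 : haveI : Fact (Nat.Prime 2) := ⟨Nat.prime_two⟩; Odd ((W.baseChange ℚ_[2]).localTamagawaNumber ℤ_[2]))
    (Wd : WeierstrassCurve ℚ) [Wd.IsElliptic] [Wd.IsGloballyMinimal]
    (hWd : ∃ C : VariableChange ℚ, C • W.quadraticTwist (NumberField.discr K : ℚ) = Wd)
    (hBW : BSDp W 2) (hBd : BSDp Wd 2) : False := by
  haveI : Fact (Nat.Prime 2) := ⟨Nat.prime_two⟩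
  obtain ⟨hodd, h3⟩ := odd_discr_and_ne_neg_three_of_split_two K hK.1 hstar.1
  -- `E(ℚ)[2] = 0`: `rank E(ℚ) = 1` (GZK) and `#Sel₂ = 2`
  obtain ⟨hrankW, -⟩ := hGZK W (by rw [hr])
  have hrk : 1 ≤ W.mordellWeilRank := by rw [hrankW, hr]
  obtain ⟨-, hT2, -⟩ := rank_eq_one_and_sha_primary_eq_zero_of_natCard_selmerGroup_eq_two W hSel hrk
  have hT2' : ∀ P : W.toAffine.Point, 2 • P = 0 → P = 0 := fun P hP ↦ by convert hT2 P (by convert hP)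
  -- (★): `P(1)` of infinite order and NOT `2`-divisible in `E(K[1])`
  obtain ⟨hy, hndiv⟩ := Star.not_isOfFinAddOrder_and_not_twoDiv_derivedPoint_of_assumptionStar W hT2' hc2 K hK hodd hH Dt hc β ι d₁
    P₀ hP₀K j hstar
  -- §1: the BSD pair makes it `2`-divisible
  exact hndiv (twoDiv_derivedPoint_of_bsdp_of_two_dvd_tamagawa' W K hGZ hGZK hmod hMilneC hr hSel h2T hK hodd h3 hH Dt hc β ι d₁ hy Wd
    hWd hBW hBd)

/-- **Leaf form.**  The leaf `NonCMAtTwo` + the route's four PRINT items REFUTE every (★)-frame of a non-CM rank-one curve with `#Sel₂ = 2` and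
even Tamagawa product (`BSD₂(E)`: non-CM of analytic rank `1`; `BSD₂(Wd)`: the twin, non-CM of analytic rank `0` — derived from Gross–Zagier).
CONDITIONAL on the leaf; BSD is NOT proved by this. [cite: KrizLi2019, Lemma 5.4 (FMS)] [cite: GrossZagier1986, V.§2 (2.3)] -/
theorem false_of_assumptionStar_of_nonCMAtTwo_of_two_dvd_tamagawa
    (hleaf : NonCMAtTwo) (hGZ : GrossZagierAllLevels) (hL : EntireLFunctionRat) (hGZK : MultPublishedInputsAtTwo) (hMi : MilneAnyModel)
    (W : WeierstrassCurve ℚ) [W.IsElliptic] [W.IsGloballyMinimal] [NeZero (W.conductorNorm ℤ)]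
    (hcm : ¬ W.HasCM) (hr : W.analyticRank = 1) (hSel : Nat.card (W.selmerGroup 2) = 2) (h2T : 2 ∣ W.tamagawaProduct)
    (K : Type) [Field K] [NumberField K] (hK : IsImaginaryQuadratic K) (hH : SatisfiesHeegnerHypothesis (W.conductorNorm ℤ) K)
    (Dt : ModularParametrizationData W (W.conductorNorm ℤ)) (hc : Odd Dt.c) (β : ℤ) (ι : K →+* ℂ)
    (d₁ : KolyvaginHeegnerData Dt β ι 1) (P₀ : (W.baseChange K).toAffine.Point)
    (hP₀K : WeierstrassCurve.Affine.Point.map (W' := W) (algebraMap K (ringClassField K ι 1)).toRatAlgHom P₀ = d₁.derivedPoint)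
    (j : K →ₐ[ℚ] ℚ_[2]) (hstar : AssumptionStar W Dt K P₀ j)
    (hc2 : haveI : Fact (Nat.Prime 2) := ⟨Nat.prime_two⟩; Odd ((W.baseChange ℚ_[2]).localTamagawaNumber ℤ_[2]))
    (Wd : WeierstrassCurve ℚ) [Wd.IsElliptic] [Wd.IsGloballyMinimal]
    (hWd : ∃ C : VariableChange ℚ, C • W.quadraticTwist (NumberField.discr K : ℚ) = Wd) : False := by
  haveI : Fact (Nat.Prime 2) := ⟨Nat.prime_two⟩
  haveI hEK : (W.baseChange K).IsElliptic := isElliptic_baseChange' W K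
  have hD0 : (NumberField.discr K : ℚ) ≠ 0 := by exact_mod_cast NumberField.discr_ne_zero K
  haveI hEt : (W.quadraticTwist (NumberField.discr K : ℚ)).IsElliptic := W.isElliptic_quadraticTwist hD0
  obtain ⟨hodd, -⟩ := odd_discr_and_ne_neg_three_of_split_two K hK.1 hstar.1
  obtain ⟨Cd, hCd⟩ := hWd
  have hBW : BSDp W 2 := hleaf W hcm (by rw [hr])
  have hcmd : ¬ Wd.HasCM := by
    rw [← hCd, hasCM_iff_of_j_eq (((W.quadraticTwist (NumberField.discr K : ℚ)).variableChange_j Cd).trans (W.j_quadraticTwist hD0))]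
    exact hcm
  -- `E(ℚ)[2] = 0`, so (★) gives `P(1)` of infinite order; then `r_an(Wd) = 0` by Gross–Zagier
  obtain ⟨hrankW, -⟩ := hGZK W (by rw [hr])
  have hrk : 1 ≤ W.mordellWeilRank := by rw [hrankW, hr]
  obtain ⟨-, hT2, -⟩ := rank_eq_one_and_sha_primary_eq_zero_of_natCard_selmerGroup_eq_two W hSel hrk
  have hT2' : ∀ P : W.toAffine.Point, 2 • P = 0 → P = 0 := fun P hP ↦ by convert hT2 P (by convert hP)
  obtain ⟨hy, -⟩ := Star.not_isOfFinAddOrder_and_not_twoDiv_derivedPoint_of_assumptionStar W hT2' hc2 K hK hodd hH Dt hc β ι d₁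
    P₀ hP₀K j hstar
  obtain ⟨P₁, Hd, hP₁, hP₁K⟩ := exists_heegnerPoint_map_eq_derivedPoint_one hK hH d₁
  have hP₁inf : ¬ IsOfFinAddOrder P₁ := fun hfin ↦ hy (by
    rw [← hP₁K]
    exact (WeierstrassCurve.Affine.Point.map (W' := W) (algebraMap K (ringClassField K ι 1)).toRatAlgHom).isOfFinAddOrder hfin)
  have hrt : (W.quadraticTwist (NumberField.discr K : ℚ)).analyticRank = 0 :=
    analyticRank_twist_eq_zero_of_rankOne W K (hGZ _ W K) hL hK hH hr ⟨Dt, Hd, ι, hP₁⟩ hP₁inf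
  have hrd : Wd.analyticRank = 0 := by rw [← hCd, analyticRank_smul, hrt]
  have hBd : BSDp Wd 2 := hleaf Wd hcmd (by rw [hrd]; exact zero_le_one)
  exact false_of_assumptionStar_of_bsdp_of_two_dvd_tamagawa W K (hGZ _ W K) hGZK hL hMi hr hSel h2T hK hH Dt hc β ι d₁ P₀ hP₀K j
    hstar hc2 Wd ⟨Cd, hCd⟩ hBW hBd

end Summit.BirchSwinnertonDyer.BirchSwinnertonDyer.Theorems.GenusExact.SuHalves.StarObstruction

/-! ## §3 ON THE K₁⁻ CELL (LINE 30): the twin has even Tamagawa product, so B1′'s (★)-frame is refuted modulo the leaf -/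

namespace Summit.BirchSwinnertonDyer.BirchSwinnertonDyer.Theorems.GenusExact.SuHalves.StarObstruction.K1Neg

open Summit.BirchSwinnertonDyer.BirchSwinnertonDyer.Theorems.GenusKolyTwin (even_tamagawaProduct_twin_of_Δ_neg)

/-- **On a `Δ < 0` Heegner frame the twin's Tamagawa product is EVEN** (so on every K₁⁻ frame `ord₂ C(Wd) = 1`): `W/ℚ` globally minimal with
`Δ_W < 0`, `K` imaginary quadratic with odd `d_K`, Heegner for `N_W`, `Wd` any elliptic model of `W^(d_K)`: `2 ∣ C(Wd)`, and with the K₁⁻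
budget `ord₂ C(Wd) ≤ 1` exactly `ord₂ C(Wd) = 1`.  (Tree `GenusKolyTwin.even_tamagawaProduct_twin_of_Δ_neg`: the number of transposition primes of
`d_K` is odd, each gives `c_q(Wd) = 2`.) [cite: SilvermanATAEC1994, IV.9.4 Step 6] -/
theorem two_dvd_tamagawaProduct_twin (W : WeierstrassCurve ℚ) [W.IsElliptic] [W.IsGloballyMinimal] (hneg : W.Δ < 0)
    {K : Type} [Field K] [NumberField K] (hK : IsImaginaryQuadratic K) (hodd : Odd (NumberField.discr K))
    (hH : SatisfiesHeegnerHypothesis (W.conductorNorm ℤ) K) (Wd : WeierstrassCurve ℚ) [Wd.IsElliptic]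
    (hWd : ∃ C : VariableChange ℚ, C • W.quadraticTwist (NumberField.discr K : ℚ) = Wd) :
    2 ∣ Wd.tamagawaProduct ∧ (padicValNat 2 Wd.tamagawaProduct ≤ 1 → padicValNat 2 Wd.tamagawaProduct = 1) := by
  haveI : Fact (Nat.Prime 2) := ⟨Nat.prime_two⟩
  obtain ⟨Cd, hCd⟩ := hWd
  have h2 : 2 ∣ Wd.tamagawaProduct := even_iff_two_dvd.mp (even_tamagawaProduct_twin_of_Δ_neg W hneg hK hodd hH Cd hCd)
  exact ⟨h2, fun hle ↦ le_antisymm hle (one_le_padicValNat_of_dvd Wd.tamagawaProduct_pos_holds.ne' h2)⟩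

/-- **LINE 30 B1′ vs the BSD pair, ON EVERY K₁⁻ FRAME.**  Binders: the K₁⁻ frame through the twin (`W` globally minimal, `Δ_W < 0`; `K` imaginary
quadratic with odd `d_K`, Heegner for `N_W`; `Wd` a globally minimal model of `W^(d_K)` with `r_an(Wd) = 1`, `#Sel₂(Wd) = 2` — the remaining K₁⁻
binders are not needed) and a package of the shape `stub_starFrameSupply` outputs for `Wd` (`K'` imaginary quadratic, Heegner for `N(Wd)`; `Dt'`
with odd `Dt'.c`; `β', ι', d₁'`; `P' ∈ Wd(K')` mapping to `d₁'.derivedPoint`; `j` with `AssumptionStar Wd Dt' K' P' j`; `c₂(Wd)` odd; `W'` a globally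
minimal model of `Wd^(d_K')`).  Then the four PRINT facts + `BSD₂(Wd) ∧ BSD₂(W')` give `False`.  (`2 ∣ C(Wd)` by
`two_dvd_tamagawaProduct_twin`, then §2 for `(Wd, K', W')`.)  CONDITIONAL on the displayed hypotheses; nothing about BSD is proved.
[cite: KrizLi2019, Lemma 5.4 (FMS)] [cite: GrossZagier1986, V.§2 (2.3)] [cite: SilvermanATAEC1994, IV.9.4 Step 6] -/
theorem starFrame_false_of_bsdp
    (W : WeierstrassCurve ℚ) [W.IsElliptic] [W.IsGloballyMinimal] (hneg : W.Δ < 0)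
    (K : Type) [Field K] [NumberField K] (hIQ : IsImaginaryQuadratic K) (hodd : Odd (NumberField.discr K))
    (hHe : SatisfiesHeegnerHypothesis (W.conductorNorm ℤ) K)
    (Wd : WeierstrassCurve ℚ) [Wd.IsElliptic] [Wd.IsGloballyMinimal] [NeZero (Wd.conductorNorm ℤ)]
    (hWd : ∃ C : VariableChange ℚ, C • W.quadraticTwist (NumberField.discr K : ℚ) = Wd)
    (hrd : Wd.analyticRank = 1) (hSel : Nat.card (Wd.selmerGroup 2) = 2)
    (K' : Type) [Field K'] [NumberField K'] (hIQ' : IsImaginaryQuadratic K')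
    (hHe' : SatisfiesHeegnerHypothesis (Wd.conductorNorm ℤ) K')
    (hGZ : gross_zagier (Wd.conductorNorm ℤ) Wd K') (hGZK : rank_eq_analyticRank_of_analyticRank_le_one)
    (hmod : hasEntireLFunction_rat) (hMilneC : Milne1972.bsdQuotient_baseChange_quadratic_anyModel)
    (Dt' : ModularParametrizationData Wd (Wd.conductorNorm ℤ)) (hc' : Odd Dt'.c)
    (β' : ℤ) (ι' : K' →+* ℂ) (d₁' : KolyvaginHeegnerData Dt' β' ι' 1)
    (P' : (Wd.baseChange K').toAffine.Point)
    (hP' : WeierstrassCurve.Affine.Point.map (W' := Wd) (algebraMap K' (ringClassField K' ι' 1)).toRatAlgHom P' = d₁'.derivedPoint)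
    (j : K' →ₐ[ℚ] ℚ_[2]) (hstar : AssumptionStar Wd Dt' K' P' j)
    (hc2 : haveI : Fact (Nat.Prime 2) := ⟨Nat.prime_two⟩; Odd ((Wd.baseChange ℚ_[2]).localTamagawaNumber ℤ_[2]))
    (W' : WeierstrassCurve ℚ) [W'.IsElliptic] [W'.IsGloballyMinimal]
    (hW' : ∃ C : VariableChange ℚ, C • Wd.quadraticTwist (NumberField.discr K' : ℚ) = W')
    (hBd : BSDp Wd 2) (hB' : BSDp W' 2) : False := by
  obtain ⟨h2T, -⟩ := two_dvd_tamagawaProduct_twin W hneg hIQ hodd hHe Wd hWd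
  exact false_of_assumptionStar_of_bsdp_of_two_dvd_tamagawa Wd K' hGZ hGZK hmod hMilneC hrd hSel h2T hIQ' hHe' Dt' hc' β' ι' d₁' P' hP'
    j hstar hc2 W' hW' hBd hB'

/-- **LINE 30 B1′ is REFUTED MODULO THE LEAF at every K₁⁻ frame** (route currency): the leaf `NonCMAtTwo` + the route's four PRINT items
(`GrossZagierAllLevels`, `EntireLFunctionRat`, `MultPublishedInputsAtTwo`, `MilneAnyModel`) + a K₁⁻ frame (`W` non-CM globally minimal, `Δ_W < 0`;
`K` odd-`d_K` Heegner; `Wd` a globally minimal model of `W^(d_K)` with `r_an(Wd) = 1`, `#Sel₂(Wd) = 2`) + a (★)-frame package for `Wd` of B1′'s shape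
⟹ `False`.  So the B-branch of LINE 30 (`rankOneHalf_of_swap` ∘ `stub_starFrameSupply`) can be completed only if the rung `NonCMAtTwo` that the
route closes is FALSE.  CONDITIONAL on the leaf; BSD is NOT proved by this; K1Neg is untouched (LINE 31 / K₁⁺ is not affected: there `C(Wd)` is odd).
[cite: KrizLi2019, Lemma 5.4 (FMS), Rem. 1.14] [cite: GrossZagier1986, V.§2 (2.3)] [cite: SilvermanATAEC1994, IV.9.4 Step 6] -/
theorem starFrame_false_of_nonCMAtTwo
    (hleaf : NonCMAtTwo) (hGZ : GrossZagierAllLevels) (hL : EntireLFunctionRat) (hGZK : MultPublishedInputsAtTwo) (hMi : MilneAnyModel)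
    (W : WeierstrassCurve ℚ) [W.IsElliptic] [W.IsGloballyMinimal] (hcm : ¬ W.HasCM) (hneg : W.Δ < 0)
    (K : Type) [Field K] [NumberField K] (hIQ : IsImaginaryQuadratic K) (hodd : Odd (NumberField.discr K))
    (hHe : SatisfiesHeegnerHypothesis (W.conductorNorm ℤ) K)
    (Wd : WeierstrassCurve ℚ) [Wd.IsElliptic] [Wd.IsGloballyMinimal] [NeZero (Wd.conductorNorm ℤ)]
    (hWd : ∃ C : VariableChange ℚ, C • W.quadraticTwist (NumberField.discr K : ℚ) = Wd)
    (hrd : Wd.analyticRank = 1) (hSel : Nat.card (Wd.selmerGroup 2) = 2)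
    (K' : Type) [Field K'] [NumberField K'] (hIQ' : IsImaginaryQuadratic K')
    (hHe' : SatisfiesHeegnerHypothesis (Wd.conductorNorm ℤ) K')
    (Dt' : ModularParametrizationData Wd (Wd.conductorNorm ℤ)) (hc' : Odd Dt'.c)
    (β' : ℤ) (ι' : K' →+* ℂ) (d₁' : KolyvaginHeegnerData Dt' β' ι' 1)
    (P' : (Wd.baseChange K').toAffine.Point)
    (hP' : WeierstrassCurve.Affine.Point.map (W' := Wd) (algebraMap K' (ringClassField K' ι' 1)).toRatAlgHom P' = d₁'.derivedPoint)
    (j : K' →ₐ[ℚ] ℚ_[2]) (hstar : AssumptionStar Wd Dt' K' P' j)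
    (hc2 : haveI : Fact (Nat.Prime 2) := ⟨Nat.prime_two⟩; Odd ((Wd.baseChange ℚ_[2]).localTamagawaNumber ℤ_[2]))
    (W' : WeierstrassCurve ℚ) [W'.IsElliptic] [W'.IsGloballyMinimal]
    (hW' : ∃ C : VariableChange ℚ, C • Wd.quadraticTwist (NumberField.discr K' : ℚ) = W') : False := by
  have hD0 : (NumberField.discr K : ℚ) ≠ 0 := by exact_mod_cast NumberField.discr_ne_zero K
  haveI hEt : (W.quadraticTwist (NumberField.discr K : ℚ)).IsElliptic := W.isElliptic_quadraticTwist hD0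
  obtain ⟨h2T, -⟩ := two_dvd_tamagawaProduct_twin W hneg hIQ hodd hHe Wd hWd
  obtain ⟨Cd, hCd⟩ := hWd
  have hcmd : ¬ Wd.HasCM := by
    rw [← hCd, hasCM_iff_of_j_eq (((W.quadraticTwist (NumberField.discr K : ℚ)).variableChange_j Cd).trans (W.j_quadraticTwist hD0))]
    exact hcm
  exact false_of_assumptionStar_of_nonCMAtTwo_of_two_dvd_tamagawa hleaf hGZ hL hGZK hMi Wd hcmd hrd hSel h2T K' hIQ' hHe' Dt' hc' β' ι'
    d₁' P' hP' j hstar hc2 W' hW'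

/-- **THE CONCLUSION OF `stub_starFrameSupply` (LINE 30 B1′, text VERBATIM as the hypothesis `hB1out`) IS REFUTED MODULO THE LEAF at every K₁⁻
frame.**  For a non-CM globally minimal `W` with `Δ_W < 0`, an odd-`d_K` Heegner field `K`, and a globally minimal twin model `Wd` of analytic rank `1`
with `#Sel₂(Wd) = 2`: the leaf `NonCMAtTwo` + the four PRINT items + B1′'s `∃`-package ⟹ `False`.  Equivalently, on the K₁⁻ cell B1′ implies
`¬ NonCMAtTwo` modulo print: the stub is false unless the route's target is.  (Only these K₁⁻ binders are used; the rest of B1′'s hypotheses —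
`r_an(W) = 0`, `ρ̄` onto, `C(W)` odd, `#Sel₂(W) = 1`, the Theorem-B₂ non-squares, `d_K ≠ −3`, `ord₂ C(Wd) ≤ 1` — only shrink the cell.)
CONDITIONAL on the leaf; BSD is NOT proved by this. [cite: KrizLi2019, Lemma 5.4 (FMS), Rem. 1.14] [cite: GrossZagier1986, V.§2 (2.3)] -/
theorem not_starFrameSupply_conclusion_of_nonCMAtTwo
    (hleaf : NonCMAtTwo) (hGZ : GrossZagierAllLevels) (hL : EntireLFunctionRat) (hGZK : MultPublishedInputsAtTwo) (hMi : MilneAnyModel)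
    (W : WeierstrassCurve ℚ) [W.IsElliptic] [W.IsGloballyMinimal] (hcm : ¬ W.HasCM) (hneg : W.Δ < 0)
    (K : Type) [Field K] [NumberField K] (hIQ : IsImaginaryQuadratic K) (hodd : Odd (NumberField.discr K))
    (hHe : SatisfiesHeegnerHypothesis (W.conductorNorm ℤ) K)
    (Wd : WeierstrassCurve ℚ) [Wd.IsElliptic] [Wd.IsGloballyMinimal] [NeZero (Wd.conductorNorm ℤ)]
    (hWd : ∃ C : VariableChange ℚ, C • W.quadraticTwist (NumberField.discr K : ℚ) = Wd)
    (hrd : Wd.analyticRank = 1) (hSel : Nat.card (Wd.selmerGroup 2) = 2)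
    (hB1out : ∃ (K' : Type) (_ : Field K') (_ : NumberField K'), IsImaginaryQuadratic K' ∧
      SatisfiesHeegnerHypothesis (Wd.conductorNorm ℤ) K' ∧
      ∃ (Dt' : ModularParametrizationData Wd (Wd.conductorNorm ℤ)), Odd Dt'.c ∧
      ∃ (β' : ℤ) (ι' : K' →+* ℂ) (d₁' : KolyvaginHeegnerData Dt' β' ι' 1) (P' : (Wd.baseChange K').toAffine.Point)
        (j : K' →ₐ[ℚ] ℚ_[2]),
        WeierstrassCurve.Affine.Point.map (algebraMap K' (ringClassField K' ι' 1)).toRatAlgHom P' = d₁'.derivedPoint ∧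
        AssumptionStar Wd Dt' K' P' j ∧
        (haveI : Fact (Nat.Prime 2) := ⟨Nat.prime_two⟩; Odd ((Wd.baseChange ℚ_[2]).localTamagawaNumber ℤ_[2])) ∧
      ∃ (W' : WeierstrassCurve ℚ) (_ : W'.IsElliptic) (_ : W'.IsGloballyMinimal),
        (∃ C : VariableChange ℚ, C • Wd.quadraticTwist (NumberField.discr K' : ℚ) = W') ∧
        W'.analyticRank = 0 ∧ (∀ Q : W'.toAffine.Point, 2 • Q = 0 → Q = 0)) : False := by
  obtain ⟨K', _, _, hIQ', hHe', Dt', hc', β', ι', d₁', P', j, hP', hstar, hc2, W', _, _, hW', -, -⟩ := hB1out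
  exact starFrame_false_of_nonCMAtTwo hleaf hGZ hL hGZK hMi W hcm hneg K hIQ hodd hHe Wd hWd hrd hSel K' hIQ' hHe' Dt' hc' β' ι' d₁' P' hP'
    j hstar hc2 W' hW'

end Summit.BirchSwinnertonDyer.BirchSwinnertonDyer.Theorems.GenusExact.SuHalves.StarObstruction.K1Neg

end
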